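import Mathlib
import HarnessLib
import Summits.Ventures.LatticeQCDFlow.Exactness.NCMCGeneralSpaceAcceptanceFloor
import Summits.Ventures.LatticeQCDFlow.Exactness.NCMCGeneralSpaceWorkLaw

/-!
# The round trip of a Crooks pair: the tempered-transition acceptance on a general state space

HONEST FRAMING: exact (Metropolis-corrected) sampling algorithms for lattice gauge theory;
figures of merit are autocorrelation/cost numbers at stated couplings and volumes; no
continuum-physics claim.

Venture `LatticeQCDFlow` (cell pub-lqcd), topic `Exactness`; FANOUT row 13 (`eng-snf`, GEN-11).
NEW WORK of the cell (general measure theory, elementary), not a published result; nothing is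
cited as a fact (R. M. Neal, Statistics and Computing 6 (1996) 353 "tempered transitions";
J. P. Nilmeier, G. E. Crooks, D. D. L. Minh, J. D. Chodera, PNAS 108 (2011) E1009 (symmetric
protocol, acceptance `min 1 e^{−W}`); Crooks 1998/2000 named only).  General-state-space
counterpart of row 8's finite `Exactness/TemperedTransitionsAcceptance.lean`
(`ttAccRate_eq_prob_add_prob`, `ttAccRate_eq_one_sub_tvDist`) and
`Exactness/TemperedTransitionsAcceptanceBounds.lean` (`ttAccRate_le_halfWork`,
`one_sub_sqrt_le_ttAccRate`, `ttAccRate_le_one_sub_tvDist_candidate`); it was the item "the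
tempered-transition (round-trip) acceptance formula" of the GEN-10 NOT-TYPED list.  Setting of
`NCMCGeneralSpace.lean` … `NCMCGeneralSpaceAcceptanceFloor.lean`: a Crooks pair `(κF, κR, s, e, W)`
from `ν₀` to `ν₁` on a general measurable state space, `P_F = fwdPathLaw ν₀ κF`, `e^{−ΔF} = Z₁/Z₀`.

WHY.  `latflow-snf` offers three exact Metropolizations of one non-equilibrium protocol: the
expanded-ensemble switch (`ncmc`), path-IMH, and TEMPERED TRANSITIONS (`snf.tempered`: from the
current state go up the protocol and come back down, accept the end point with `min 1 e^{−W_rt}`).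
`NCMCGeneralSpaceTempered.lean` typed the EXACTNESS of the third (`temperedTransition_isReversible`);
this file types its ACCEPTANCE, which the engine measures, and what bounds it from measured works.

## Content

* `CrooksPair.integrable_exp_half`, **`CrooksPair.integral_accept_le_integral_exp_half`** — the
  HALF-WORK CAP for the one-way switch, any Crooks pair: `acc(ΔF) ≤ B := E_{P_F}[e^{−(W−ΔF)/2}]`
  (pointwise `min(1, d) ≤ √d`); with `NCMCGeneralSpaceAcceptanceFloor.sq_integral_exp_half_le`
  (`B² ≤ acc(2 − acc)`) the general-space Le Cam sandwich **`1 − √(1 − B²) ≤ acc ≤ B`**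
  (`one_sub_sqrt_bhatt_le_accept`), and `B ≤ 1` (`integral_exp_half_le_one`).
* `fwdPathLaw_compRev` — for the ROUND TRIP of a Crooks pair (`CrooksPair.roundTrip`: records
  `E × E`, work `W_rt(ε) = W(ε.1) − W(ε.2)`, a Crooks pair from `ν₀` to ITSELF, so `ΔF_rt = 0`:
  `exp_neg_zero_eq_ratio_self`) the reverse record law is the forward one with the legs swapped:
  `P_rt^R = P_rt ∘ swap⁻¹` — TIME REVERSAL OF A ROUND TRIP IS THE LEG SWAP.
* **`CrooksPair.ttAccept_eq`** — THE TEMPERED-TRANSITION ACCEPTANCE: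
  `a_TT := E_{P_rt}[min(1, e^{−W_rt})] = P_rt{W_rt ≤ 0} + P_rt{W_rt < 0}`
  (`= 2·P_rt{W_rt < 0} + P_rt{W_rt = 0}`, `ttAccept_eq_two_mul_add`: Nilmeier et al.'s
  symmetric-protocol formula), for EVERY Crooks pair — adjoint stochastic steps, Jacobian-charged
  layers, concatenations — on the engine's state space; `lintegral_fwdFlow_univ_eq` identifies it
  with the stationary acceptance mass of the kernel `ttKernel` of `NCMCGeneralSpaceTempered.lean`.
* **`CrooksPair.abs_measureReal_sub_swap_le`** / `measureReal_sub_swap_eq` — `a_TT = 1 − TV(P_rt,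
  P_rt ∘ swap⁻¹)` in sup-over-events form: `|P_rt(A) − P_rt(swap⁻¹A)| ≤ 1 − a_TT` for every
  measurable `A`, attained at `A = {W_rt > 0}`; `ttAccept_eq_one_iff` — sure acceptance iff the
  round-trip law is swap-invariant iff `W_rt = 0` a.s.
* `CrooksPair.integral_exp_neg_roundTripWork` (`E[e^{−W_rt}] = 1`), `integral_roundTripWork_nonneg`
  (`E[W_rt] ≥ 0`), **`map_roundTripWork_eq_withDensity`** (the round-trip work law is `e^{w}` times
  the law of `−W_rt`: the symmetric fluctuation relation), `roundTripWork_mean_of_gaussian` (a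
  Gaussian `W_rt ∼ N(m, v)` is forced to have `m = v/2`).
* Bounds from measured works, all laws: `one_sub_sqrt_le_ttAccept` (`a_TT ≥ 1 − √(1 − e^{−E[W_rt]})`,
  Bretagnolle–Huber), `ttAccept_le_integral_exp_half` / `one_sub_sqrt_bhatt_le_ttAccept` (half-work
  sandwich), and **`CrooksPair.abs_prior_sub_candidate_le`** — THE CANDIDATE-LAW CAP: for every
  measurable `B ⊆ Ω`, `|π₀(B) − ν(B)| ≤ 1 − a_TT`, `π₀ = ν₀/Z₀` the target of the chain and `ν` the
  law of the CANDIDATE end state of a round trip started in equilibrium (data processing along the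
  start coordinate; `map_start_fwdPathLaw`: the start marginal of `P_F` is `π₀`).

Nothing is claimed about any VALUE of an acceptance or a work moment for a concrete protocol.
-/

namespace Summit.Ventures.LatticeQCDFlow.Exactness.GeneralNCMC

open MeasureTheory ProbabilityTheory Set Filter
open scoped ENNReal

variable {Ω E : Type*} [MeasurableSpace Ω] [MeasurableSpace E]

/-! ## Bookkeeping: stationary acceptance mass, self-pairs, start marginals -/

/-- The stationary accepted mass of a one-switch flow is the record-law integral of the acceptance:
`∫ F_c(x, Ω) dν(x) = ∫ min(1, e^{−(W−c)}) d(ν ∘ κ)` — so the mean acceptance of the Metropolized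
switch / of `ttKernel κ W e` (`NCMCGeneralSpaceTempered.ttKernel_apply`) in stationarity is the
normalised record-law integral studied below. -/
theorem lintegral_fwdFlow_univ_eq (ν : Measure Ω) (κ : Kernel Ω E) (c : ℝ) {W : E → ℝ}
    (hW : Measurable W) (e : E → Ω) :
    ∫⁻ x, fwdFlow κ c W e x univ ∂ν = ∫⁻ ε, accF c W ε ∂(ν.bind κ) := by
  simp_rw [fwdFlow_univ]
  exact (Measure.lintegral_bind (Kernel.aemeasurable _) (measurable_accF c hW).aemeasurable).symm

/-- For a self-pair (`ν₁ = ν₀`, e.g. a round trip) the free-energy difference is `0`: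
`e^{−0} = (ν₀ Ω)⁻¹ ν₀ Ω` (the hypothesis `hΔF` of the `NCMCGeneralSpace*` files at `ΔF = 0`). -/
theorem exp_neg_zero_eq_ratio_self (ν₀ : Measure Ω) [IsFiniteMeasure ν₀] (h0 : ν₀ univ ≠ 0) :
    Real.exp (-0) = ((ν₀ univ)⁻¹ * ν₀ univ).toReal := by
  rw [neg_zero, Real.exp_zero, ENNReal.inv_mul_cancel h0 (measure_ne_top ν₀ univ),
    ENNReal.toReal_one]

/-- **Time reversal of a round trip is the leg swap**: the normalised reverse record law of the
round trip (`compRev κR κF e`, from `ν₀`) is the forward one (`compFwd κF κR e`, from `ν₀`) pushed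
through `Prod.swap`. -/
theorem fwdPathLaw_compRev (ν₀ : Measure Ω) (κF κR : Kernel Ω E) (e : E → Ω) (he : Measurable e) :
    fwdPathLaw ν₀ (compRev κR κF e he) = (fwdPathLaw ν₀ (compFwd κF κR e he)).map Prod.swap := by
  rw [fwdPathLaw, fwdPathLaw, Measure.map_smul, compRev_eq_map_compFwd,
    ← Measure.map_comp _ _ measurable_swap]

namespace CrooksPair

variable {ν₀ ν₁ : Measure Ω} {κF κR : Kernel Ω E} {s e : E → Ω} {W : E → ℝ}

/-- **The start marginal of `P_F` is the normalised prior**: `s_* P_F = (ν₀ Ω)⁻¹ • ν₀`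
(`map_end_bind_rev` for the pair read backwards). -/
theorem map_start_fwdPathLaw [IsMarkovKernel κF] (h : CrooksPair ν₀ ν₁ κF κR s e W) :
    (fwdPathLaw ν₀ κF).map s = (ν₀ univ)⁻¹ • ν₀ := by
  rw [fwdPathLaw, Measure.map_smul, h.symm.map_end_bind_rev]

/-! ## The half-work cap and the Le Cam sandwich (one-way switch) -/

/-- `e^{−(W−ΔF)/2}` is `P_F`-integrable (bounded by `1 + e^{−(W−ΔF)}`). -/
theorem integrable_exp_half [IsFiniteMeasure ν₀] [IsFiniteMeasure ν₁] [IsMarkovKernel κF]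
    [IsMarkovKernel κR] (h0 : ν₀ univ ≠ 0) (h : CrooksPair ν₀ ν₁ κF κR s e W) (ΔF : ℝ) :
    Integrable (fun ε => Real.exp (-(W ε - ΔF) / 2)) (fwdPathLaw ν₀ κF) := by
  haveI := isProbabilityMeasure_fwdPathLaw ν₀ h0 κF
  have hform : ∀ ε, Real.exp (-(W ε - ΔF)) = Real.exp (ΔF - W ε) := fun ε => by
    rw [show -(W ε - ΔF) = ΔF - W ε by ring]
  have hdi : Integrable (fun ε => Real.exp (-(W ε - ΔF))) (fwdPathLaw ν₀ κF) := by
    simp_rw [hform]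
    exact h.integrable_density h0 ΔF
  have hB : Integrable (fun ε => 1 + Real.exp (-(W ε - ΔF))) (fwdPathLaw ν₀ κF) :=
    (integrable_const 1).add hdi
  have hum : Measurable fun ε => Real.exp (-(W ε - ΔF) / 2) :=
    Real.measurable_exp.comp ((h.measurable_W.sub measurable_const).neg.div_const 2)
  have husq : ∀ ε, Real.exp (-(W ε - ΔF) / 2) ^ 2 = Real.exp (-(W ε - ΔF)) := fun ε => by
    rw [sq, ← Real.exp_add]
    congr 1
    ring
  refine hB.mono' hum.aestronglyMeasurable (Eventually.of_forall fun ε => ?_)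
  rw [Real.norm_eq_abs, abs_of_pos (Real.exp_pos _), ← husq]
  nlinarith [Real.exp_pos (-(W ε - ΔF) / 2), sq_nonneg (Real.exp (-(W ε - ΔF) / 2) - 1)]

/-- **The half-work cap**: `acc(ΔF) = E_{P_F}[min(1, e^{−(W−ΔF)})] ≤ E_{P_F}[e^{−(W−ΔF)/2}]` —
pointwise `min(1, d) ≤ √d`; the right side is the Bhattacharyya coefficient of `P_F` and `P_R`
(`dP_R/dP_F = e^{ΔF−W}`).  Finite round-trip version: row 8's `ttAccRate_le_halfWork`. -/
theorem integral_accept_le_integral_exp_half [IsFiniteMeasure ν₀] [IsFiniteMeasure ν₁]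
    [IsMarkovKernel κF] [IsMarkovKernel κR] (h0 : ν₀ univ ≠ 0) (h : CrooksPair ν₀ ν₁ κF κR s e W)
    (ΔF : ℝ) :
    ∫ ε, min 1 (Real.exp (-(W ε - ΔF))) ∂(fwdPathLaw ν₀ κF) ≤
      ∫ ε, Real.exp (-(W ε - ΔF) / 2) ∂(fwdPathLaw ν₀ κF) := by
  refine integral_mono (h.integrable_accept h0 ΔF) (h.integrable_exp_half h0 ΔF) fun ε => ?_
  dsimp only
  have hu := Real.exp_pos (-(W ε - ΔF) / 2)
  have husq : Real.exp (-(W ε - ΔF)) = Real.exp (-(W ε - ΔF) / 2) ^ 2 := by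
    rw [sq, ← Real.exp_add]
    congr 1
    ring
  rw [husq]
  rcases le_total 1 (Real.exp (-(W ε - ΔF) / 2)) with hle | hle
  · exact (min_le_left _ _).trans hle
  · exact (min_le_right _ _).trans (by nlinarith)

/-- `B = E_{P_F}[e^{−(W−ΔF)/2}] ≤ 1` (from `B² ≤ acc(2 − acc) ≤ 1`). -/
theorem integral_exp_half_le_one [IsFiniteMeasure ν₀] [IsFiniteMeasure ν₁] [IsMarkovKernel κF]
    [IsMarkovKernel κR] (h0 : ν₀ univ ≠ 0) (h : CrooksPair ν₀ ν₁ κF κR s e W) {ΔF : ℝ}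
    (hΔF : Real.exp (-ΔF) = ((ν₀ univ)⁻¹ * ν₁ univ).toReal) :
    ∫ ε, Real.exp (-(W ε - ΔF) / 2) ∂(fwdPathLaw ν₀ κF) ≤ 1 := by
  have hsq := h.sq_integral_exp_half_le h0 hΔF
  set a := ∫ ε, min 1 (Real.exp (-(W ε - ΔF))) ∂(fwdPathLaw ν₀ κF)
  set B := ∫ ε, Real.exp (-(W ε - ΔF) / 2) ∂(fwdPathLaw ν₀ κF)
  have hB0 : 0 ≤ B := integral_nonneg fun ε => (Real.exp_pos _).le
  have hB1 : B ^ 2 ≤ 1 := by nlinarith [hsq, sq_nonneg (1 - a)]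
  exact (pow_le_one_iff_of_nonneg hB0 two_ne_zero).1 hB1

/-- **The Le Cam floor in half-work form**: `1 − √(1 − B²) ≤ acc(ΔF)`, `B = E_{P_F}[e^{−(W−ΔF)/2}]`
(`B² ≤ acc(2 − acc) = 1 − (1 − acc)²`).  With `integral_accept_le_integral_exp_half` this is the
general-space sandwich `1 − √(1 − B²) ≤ acc ≤ B`; finite round-trip version: row 8's
`one_sub_sqrt_le_ttAccRate`. -/
theorem one_sub_sqrt_bhatt_le_accept [IsFiniteMeasure ν₀] [IsFiniteMeasure ν₁]
    [IsMarkovKernel κF] [IsMarkovKernel κR] (h0 : ν₀ univ ≠ 0) (h : CrooksPair ν₀ ν₁ κF κR s e W)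
    {ΔF : ℝ} (hΔF : Real.exp (-ΔF) = ((ν₀ univ)⁻¹ * ν₁ univ).toReal) :
    1 - Real.sqrt (1 - (∫ ε, Real.exp (-(W ε - ΔF) / 2) ∂(fwdPathLaw ν₀ κF)) ^ 2) ≤
      ∫ ε, min 1 (Real.exp (-(W ε - ΔF))) ∂(fwdPathLaw ν₀ κF) := by
  have hsq := h.sq_integral_exp_half_le h0 hΔF
  set a := ∫ ε, min 1 (Real.exp (-(W ε - ΔF))) ∂(fwdPathLaw ν₀ κF)
  set B := ∫ ε, Real.exp (-(W ε - ΔF) / 2) ∂(fwdPathLaw ν₀ κF)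
  have h1 : (1 - a) ^ 2 ≤ 1 - B ^ 2 := by nlinarith [hsq]
  have := Real.le_sqrt_of_sq_le h1
  linarith

end CrooksPair

/-! ## The round trip of a Crooks pair: the tempered-transition acceptance -/

section RoundTrip

variable [MeasurableSingletonClass Ω]
variable {ν₀ ν₁ : Measure Ω} {κF κR : Kernel Ω E} {s e : E → Ω} {W : E → ℝ}

namespace CrooksPair

/-- **The tempered-transition acceptance.**  For every Crooks pair from `ν₀` to `ν₁`, the mean
acceptance of the round trip started in `ν₀`-equilibrium,
`a_TT = E_{P_rt}[min(1, e^{−W_rt})]`, `W_rt(ε) = W(ε.1) − W(ε.2)`, is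
`P_rt{W_rt ≤ 0} + P_rt{W_rt < 0}` (the two-direction formula at `ΔF_rt = 0`, the reverse law being
the leg-swapped forward law, under which `{W_rt > 0}` becomes `{W_rt < 0}`). -/
theorem ttAccept_eq [IsFiniteMeasure ν₀] [SFinite ν₁] [IsMarkovKernel κF] [IsMarkovKernel κR]
    (h0 : ν₀ univ ≠ 0) (h : CrooksPair ν₀ ν₁ κF κR s e W) :
    ∫ ε, min 1 (Real.exp (-(W ε.1 + -W ε.2))) ∂(fwdPathLaw ν₀ (compFwd κF κR e h.measurable_e)) =
      (fwdPathLaw ν₀ (compFwd κF κR e h.measurable_e)).real {ε | W ε.1 + -W ε.2 ≤ 0} +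
        (fwdPathLaw ν₀ (compFwd κF κR e h.measurable_e)).real {ε | W ε.1 + -W ε.2 < 0} := by
  have hrt := h.roundTrip
  have key := hrt.integral_accept_freeEnergyDiff h0 h0 (exp_neg_zero_eq_ratio_self ν₀ h0)
  simp only [sub_zero] at key
  rw [key, fwdPathLaw_compRev,
    map_measureReal_apply measurable_swap (measurableSet_lt measurable_const hrt.measurable_W)]
  congr 2
  ext ε
  simp only [mem_preimage, mem_setOf_eq, Prod.fst_swap, Prod.snd_swap]
  constructor <;> intro h' <;> linarith

/-- **Nilmeier et al.'s form**: `a_TT = 2·P_rt{W_rt < 0} + P_rt{W_rt = 0}`. -/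
theorem ttAccept_eq_two_mul_add [IsFiniteMeasure ν₀] [SFinite ν₁] [IsMarkovKernel κF]
    [IsMarkovKernel κR] (h0 : ν₀ univ ≠ 0) (h : CrooksPair ν₀ ν₁ κF κR s e W) :
    ∫ ε, min 1 (Real.exp (-(W ε.1 + -W ε.2))) ∂(fwdPathLaw ν₀ (compFwd κF κR e h.measurable_e)) =
      2 * (fwdPathLaw ν₀ (compFwd κF κR e h.measurable_e)).real {ε | W ε.1 + -W ε.2 < 0} +
        (fwdPathLaw ν₀ (compFwd κF κR e h.measurable_e)).real {ε | W ε.1 + -W ε.2 = 0} := by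
  haveI := isProbabilityMeasure_fwdPathLaw ν₀ h0 (compFwd κF κR e h.measurable_e)
  have hrt := h.roundTrip
  rw [h.ttAccept_eq h0]
  have hsplit : {ε : E × E | W ε.1 + -W ε.2 ≤ 0} =
      {ε | W ε.1 + -W ε.2 < 0} ∪ {ε | W ε.1 + -W ε.2 = 0} := by
    ext ε
    simp only [mem_setOf_eq, mem_union]
    exact le_iff_lt_or_eq
  have hdisj : Disjoint {ε : E × E | W ε.1 + -W ε.2 < 0} {ε | W ε.1 + -W ε.2 = 0} := by
    rw [Set.disjoint_left]
    intro ε h1 h2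
    simp only [mem_setOf_eq] at h1 h2
    linarith
  have hm0 : MeasurableSet {ε : E × E | W ε.1 + -W ε.2 = 0} :=
    hrt.measurable_W (measurableSet_singleton 0)
  rw [hsplit, measureReal_union hdisj hm0]
  ring

/-- **`a_TT = 1 − TV(P_rt, P_rt ∘ swap⁻¹)`**, operational form: for every measurable set of round-trip
records `A`, `|P_rt(A) − P_rt(swap⁻¹ A)| ≤ 1 − a_TT` — the rejection rate of tempered transitions is
the largest discrepancy in probability any test can exhibit between the round-trip ensemble and its
own time reversal.  Finite version: row 8's `ttAccRate_eq_one_sub_tvDist`. -/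
theorem abs_measureReal_sub_swap_le [IsFiniteMeasure ν₀] [SFinite ν₁] [IsMarkovKernel κF]
    [IsMarkovKernel κR] (h0 : ν₀ univ ≠ 0) (h : CrooksPair ν₀ ν₁ κF κR s e W) {A : Set (E × E)}
    (hA : MeasurableSet A) :
    |(fwdPathLaw ν₀ (compFwd κF κR e h.measurable_e)).real A -
        (fwdPathLaw ν₀ (compFwd κF κR e h.measurable_e)).real (Prod.swap ⁻¹' A)| ≤
      1 - ∫ ε, min 1 (Real.exp (-(W ε.1 + -W ε.2))) ∂(fwdPathLaw ν₀ (compFwd κF κR e h.measurable_e)) := by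
  have key := h.roundTrip.abs_measureReal_sub_le_one_sub_accept h0 h0
    (exp_neg_zero_eq_ratio_self ν₀ h0) hA
  simp only [sub_zero] at key
  rwa [fwdPathLaw_compRev, map_measureReal_apply measurable_swap hA] at key

/-- **… attained at `A = {W_rt > 0}`**: `P_rt{W_rt > 0} − P_rt{W_rt < 0} = 1 − a_TT`. -/
theorem measureReal_sub_swap_eq [IsFiniteMeasure ν₀] [SFinite ν₁] [IsMarkovKernel κF]
    [IsMarkovKernel κR] (h0 : ν₀ univ ≠ 0) (h : CrooksPair ν₀ ν₁ κF κR s e W) :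
    (fwdPathLaw ν₀ (compFwd κF κR e h.measurable_e)).real {ε | 0 < W ε.1 + -W ε.2} -
        (fwdPathLaw ν₀ (compFwd κF κR e h.measurable_e)).real {ε | W ε.1 + -W ε.2 < 0} =
      1 - ∫ ε, min 1 (Real.exp (-(W ε.1 + -W ε.2))) ∂(fwdPathLaw ν₀ (compFwd κF κR e h.measurable_e)) := by
  have hrt := h.roundTrip
  have key := hrt.measureReal_sub_eq_one_sub_accept h0 h0 (exp_neg_zero_eq_ratio_self ν₀ h0)
  simp only [sub_zero] at key
  rw [fwdPathLaw_compRev,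
    map_measureReal_apply measurable_swap (measurableSet_lt measurable_const hrt.measurable_W)] at key
  rw [← key]
  congr 2
  ext ε
  simp only [mem_preimage, mem_setOf_eq, Prod.fst_swap, Prod.snd_swap]
  constructor <;> intro h' <;> linarith

/-- **Sure acceptance iff the round-trip ensemble is time-reversal invariant iff every round trip
is work-free**: `a_TT = 1 ↔ P_rt = P_rt ∘ swap⁻¹`, and `P_rt = P_rt ∘ swap⁻¹ ↔ W_rt = 0` `P_rt`-a.s.
Finite version: row 8's `ttAccRate_eq_one_iff`. -/
theorem ttAccept_eq_one_iff [IsFiniteMeasure ν₀] [SFinite ν₁] [IsMarkovKernel κF]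
    [IsMarkovKernel κR] (h0 : ν₀ univ ≠ 0) (h : CrooksPair ν₀ ν₁ κF κR s e W) :
    (∫ ε, min 1 (Real.exp (-(W ε.1 + -W ε.2))) ∂(fwdPathLaw ν₀ (compFwd κF κR e h.measurable_e)) = 1 ↔
        fwdPathLaw ν₀ (compFwd κF κR e h.measurable_e) =
          (fwdPathLaw ν₀ (compFwd κF κR e h.measurable_e)).map Prod.swap) ∧
      (fwdPathLaw ν₀ (compFwd κF κR e h.measurable_e) =
          (fwdPathLaw ν₀ (compFwd κF κR e h.measurable_e)).map Prod.swap ↔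
        ∀ᵐ ε ∂(fwdPathLaw ν₀ (compFwd κF κR e h.measurable_e)), W ε.1 + -W ε.2 = 0) := by
  have hrt := h.roundTrip
  have k1 := hrt.accept_eq_one_iff h0 h0 (exp_neg_zero_eq_ratio_self ν₀ h0)
  have k2 := hrt.fwdPathLaw_eq_revPathLaw_iff h0 h0 (exp_neg_zero_eq_ratio_self ν₀ h0)
  simp only [sub_zero] at k1
  rw [fwdPathLaw_compRev] at k1 k2
  exact ⟨k1, k2⟩

/-! ### The round-trip work: Jarzynski, second law, fluctuation symmetry -/

/-- **`E_{P_rt}[e^{−W_rt}] = 1`** — Jarzynski for the round trip (`ΔF_rt = 0`). -/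
theorem integral_exp_neg_roundTripWork [IsFiniteMeasure ν₀] [SFinite ν₁] [IsMarkovKernel κF]
    [IsMarkovKernel κR] (h0 : ν₀ univ ≠ 0) (h : CrooksPair ν₀ ν₁ κF κR s e W) :
    ∫ ε, Real.exp (-(W ε.1 + -W ε.2)) ∂(fwdPathLaw ν₀ (compFwd κF κR e h.measurable_e)) = 1 := by
  rw [h.roundTrip.integral_exp_neg_work, ENNReal.inv_mul_cancel h0 (measure_ne_top ν₀ univ),
    ENNReal.toReal_one]

/-- **Second law for the round trip**: `0 ≤ E_{P_rt}[W_rt]` for an integrable round-trip work. -/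
theorem integral_roundTripWork_nonneg [IsFiniteMeasure ν₀] [SFinite ν₁] [IsMarkovKernel κF]
    [IsMarkovKernel κR] (h0 : ν₀ univ ≠ 0) (h : CrooksPair ν₀ ν₁ κF κR s e W)
    (hW : Integrable (fun ε : E × E => W ε.1 + -W ε.2) (fwdPathLaw ν₀ (compFwd κF κR e h.measurable_e))) :
    0 ≤ ∫ ε, (W ε.1 + -W ε.2) ∂(fwdPathLaw ν₀ (compFwd κF κR e h.measurable_e)) :=
  h.roundTrip.freeEnergyDiff_le_integral_work h0 (exp_neg_zero_eq_ratio_self ν₀ h0) hW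

/-- **Fluctuation symmetry of the round-trip work**: the law of `W_rt` under `P_rt` is `e^{w}` times
the law of `−W_rt` (Crooks' work fluctuation theorem at `ΔF = 0` with the reverse law the leg swap;
for densities `p_rt(w) = e^{w} p_rt(−w)`). -/
theorem map_roundTripWork_eq_withDensity [IsFiniteMeasure ν₀] [SFinite ν₁] [IsMarkovKernel κF]
    [IsMarkovKernel κR] (h0 : ν₀ univ ≠ 0) (h : CrooksPair ν₀ ν₁ κF κR s e W) :
    (fwdPathLaw ν₀ (compFwd κF κR e h.measurable_e)).map (fun ε => W ε.1 + -W ε.2) =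
      ((fwdPathLaw ν₀ (compFwd κF κR e h.measurable_e)).map (fun ε => -(W ε.1 + -W ε.2))).withDensity
        fun w => ENNReal.ofReal (Real.exp w) := by
  have hrt := h.roundTrip
  have key := hrt.map_work_fwdPathLaw_eq_withDensity h0 h0 (exp_neg_zero_eq_ratio_self ν₀ h0)
  simp only [sub_zero] at key
  rw [fwdPathLaw_compRev, Measure.map_map hrt.measurable_W measurable_swap] at key
  have hcomp : ((fun ε : E × E => W ε.1 + -W ε.2) ∘ Prod.swap) = fun ε => -(W ε.1 + -W ε.2) := by
    funext ε
    simp only [Function.comp_apply, Prod.fst_swap, Prod.snd_swap]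
    ring
  rwa [hcomp] at key

/-- **A Gaussian round-trip work has mean half its variance**: if `W_rt ∼ N(m, v)` under `P_rt`
then `m = v/2` (Jarzynski forces it: `NCMCGeneralSpaceWorkLaw.freeEnergyDiff_eq_of_gaussian` at
`ΔF = 0`) — the one-parameter family behind the engine's tempered-mode planning numbers is forced,
not assumed. -/
theorem roundTripWork_mean_of_gaussian [IsFiniteMeasure ν₀] [SFinite ν₁] [IsMarkovKernel κF]
    [IsMarkovKernel κR] (h0 : ν₀ univ ≠ 0) (h : CrooksPair ν₀ ν₁ κF κR s e W) {m : ℝ} {v : NNReal}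
    (hG : (fwdPathLaw ν₀ (compFwd κF κR e h.measurable_e)).map (fun ε => W ε.1 + -W ε.2) =
      gaussianReal m v) : m = (v : ℝ) / 2 := by
  have key := h.roundTrip.freeEnergyDiff_eq_of_gaussian (exp_neg_zero_eq_ratio_self ν₀ h0) hG
  linarith

/-! ### Bounds on the tempered-transition acceptance from measured works -/

/-- **`a_TT ≥ 1 − √(1 − e^{−E[W_rt]})`** — the work-law-free floor (Bretagnolle–Huber,
`NCMCGeneralSpaceAcceptanceFloor.one_sub_sqrt_le_accept` at `ΔF = 0`), integrable round-trip work. -/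
theorem one_sub_sqrt_le_ttAccept [IsFiniteMeasure ν₀] [SFinite ν₁] [IsMarkovKernel κF]
    [IsMarkovKernel κR] (h0 : ν₀ univ ≠ 0) (h : CrooksPair ν₀ ν₁ κF κR s e W)
    (hW : Integrable (fun ε : E × E => W ε.1 + -W ε.2) (fwdPathLaw ν₀ (compFwd κF κR e h.measurable_e))) :
    1 - Real.sqrt (1 - Real.exp (-∫ ε, (W ε.1 + -W ε.2) ∂(fwdPathLaw ν₀ (compFwd κF κR e h.measurable_e)))) ≤
      ∫ ε, min 1 (Real.exp (-(W ε.1 + -W ε.2))) ∂(fwdPathLaw ν₀ (compFwd κF κR e h.measurable_e)) := by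
  have key := h.roundTrip.one_sub_sqrt_le_accept h0 (exp_neg_zero_eq_ratio_self ν₀ h0) hW
  simp only [sub_zero] at key
  exact key

/-- **Half-work cap for tempered transitions**: `a_TT ≤ E_{P_rt}[e^{−W_rt/2}]` (finite version:
row 8's `ttAccRate_le_halfWork`). -/
theorem ttAccept_le_integral_exp_half [IsFiniteMeasure ν₀] [SFinite ν₁] [IsMarkovKernel κF]
    [IsMarkovKernel κR] (h0 : ν₀ univ ≠ 0) (h : CrooksPair ν₀ ν₁ κF κR s e W) :
    ∫ ε, min 1 (Real.exp (-(W ε.1 + -W ε.2))) ∂(fwdPathLaw ν₀ (compFwd κF κR e h.measurable_e)) ≤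
      ∫ ε, Real.exp (-(W ε.1 + -W ε.2) / 2) ∂(fwdPathLaw ν₀ (compFwd κF κR e h.measurable_e)) := by
  have key := h.roundTrip.integral_accept_le_integral_exp_half h0 0
  simp only [sub_zero] at key
  exact key

/-- **Le Cam floor for tempered transitions**: `1 − √(1 − B_rt²) ≤ a_TT`, `B_rt = E_{P_rt}[e^{−W_rt/2}]`
(finite version: row 8's `one_sub_sqrt_le_ttAccRate`). -/
theorem one_sub_sqrt_bhatt_le_ttAccept [IsFiniteMeasure ν₀] [SFinite ν₁] [IsMarkovKernel κF]
    [IsMarkovKernel κR] (h0 : ν₀ univ ≠ 0) (h : CrooksPair ν₀ ν₁ κF κR s e W) :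
    1 - Real.sqrt (1 - (∫ ε, Real.exp (-(W ε.1 + -W ε.2) / 2)
        ∂(fwdPathLaw ν₀ (compFwd κF κR e h.measurable_e))) ^ 2) ≤
      ∫ ε, min 1 (Real.exp (-(W ε.1 + -W ε.2))) ∂(fwdPathLaw ν₀ (compFwd κF κR e h.measurable_e)) := by
  have key := h.roundTrip.one_sub_sqrt_bhatt_le_accept h0 (exp_neg_zero_eq_ratio_self ν₀ h0)
  simp only [sub_zero] at key
  exact key

/-- **The candidate-law cap.**  `π₀ = (ν₀ Ω)⁻¹ • ν₀` the law the chain samples, `ν` the law of the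
CANDIDATE end state `s(ε.2)` of a round trip started in equilibrium: for every measurable `B ⊆ Ω`,
`|π₀(B) − ν(B)| ≤ 1 − a_TT` — tempered transitions cannot accept more often than their raw candidates
overlap the target (the event "the start point lies in `B`" and its time reversal "the candidate lies
in `B`" in `abs_measureReal_sub_swap_le`).  Finite version: row 8's
`ttAccRate_le_one_sub_tvDist_candidate`. -/
theorem abs_prior_sub_candidate_le [IsFiniteMeasure ν₀] [SFinite ν₁] [IsMarkovKernel κF]
    [IsMarkovKernel κR] (h0 : ν₀ univ ≠ 0) (h : CrooksPair ν₀ ν₁ κF κR s e W) {B : Set Ω}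
    (hB : MeasurableSet B) :
    |((ν₀ univ)⁻¹ • ν₀).real B -
        ((fwdPathLaw ν₀ (compFwd κF κR e h.measurable_e)).map fun ε => s ε.2).real B| ≤
      1 - ∫ ε, min 1 (Real.exp (-(W ε.1 + -W ε.2))) ∂(fwdPathLaw ν₀ (compFwd κF κR e h.measurable_e)) := by
  have hrt := h.roundTrip
  have hA : MeasurableSet ((fun ε : E × E => s ε.1) ⁻¹' B) := hrt.measurable_s hB
  have key := h.abs_measureReal_sub_swap_le h0 hA
  have hpre : Prod.swap ⁻¹' ((fun ε : E × E => s ε.1) ⁻¹' B) = (fun ε : E × E => s ε.2) ⁻¹' B := rfl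
  rw [hpre] at key
  rw [← hrt.map_start_fwdPathLaw, map_measureReal_apply hrt.measurable_s hB,
    map_measureReal_apply hrt.measurable_e hB]
  exact key

end CrooksPair

end RoundTrip

end Summit.Ventures.LatticeQCDFlow.Exactness.GeneralNCMC
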